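import Summits.BirchSwinnertonDyer.Rank1Residual.Supersingular.SignedRankZero
import Literature.NumberTheory.EllipticCurves.Rank1Residual.Typed.X8
import HarnessLib

/-!
# Class X8 (`p = 3` good supersingular, `a_3 = ±3`), analytic rank `0`: `BSD(E,3)` from ONE
# divisibility of Sprung's ♯/♭ main conjecture — the ♯/♭ reading of the signed rank-zero chain
# (cell `b2b-bsdres`, supersingular family, prover B = unit `b2b-bsdres-additive-p3`)

HONEST FRAMING (run/shared/lean/b2b/bsd-rank1-residual/, verbatim in every file): the goal of the
cell is to DELETE the COMBINATION-SHAPED residual classes of the Birch–Swinnerton-Dyer formula for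
ALL analytic-rank `≤ 1` elliptic curves over `ℚ` — "full BSD formula for every rank `≤ 1` curve in
class `C`" assembled STRICTLY from published theorems — so that the rank-`≤ 1` remainder becomes
exactly the CONSTRUCTION-SHAPED classes, which are TYPED (missing-input `Prop`s), NOT attempted.
This is not "finishing BSD". Theorems only; NO named fact, NO new definition; no label change (X8
stays CONSTRUCTION-SHAPED); nothing about any curve is asserted; nothing is booked.

## What this file is

Prover A of the supersingular family (unit `b2b-bsdres-x10b`, gen 3) recorded in
`Supersingular/SignedRankZero.lean` (p206397) the published CHAIN that turns ONE divisibility of a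
signed main conjecture into the typed lower bound `MissingLowerBoundAt W p` in analytic rank `0`:
a hypothesis structure `SignedDatum W p = (ξ, L ∈ Λ, c ∈ ℕ)` with the predicates (K) Euler
characteristic `ξ(0) ∼ #Sel_{p^∞}(E/ℚ)·∏c_ℓ`, (P) interpolation `L(0) = c·L(E,1)/Ω_E`, (MC↓)
`L ∣ ξ`, and the theorem `missingLowerBoundAt_of_signedLowerDivisibility`. That structure is
SIGN-AGNOSTIC: nothing in it is specific to Kobayashi's `±` (the case `a_p = 0`). The present file is
its reading for the OTHER supersingular case, class X8 (`ClassX8 W p := p = 3 ∧ GoodSS W 3 ∧ a_3 ≠ 0`,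
the only supersingular case with `a_p ≠ 0`), where the signed objects are Sprung's CHROMATIC
(`♯/♭`) ones:

* the datum: `ξ` = a characteristic power series of `X^•(E/ℚ_∞) = Hom(Sel^•(E/ℚ_∞), ℚ_p/ℤ_p)`,
  `• ∈ {♯, ♭}` chosen with `L^•_p(E,X) ≠ 0` — Λ-torsion by F. Sprung, J. Number Theory 132 (2012)
  1483–1506, **Thm. 1.2** ("Choose `∗ ∈ {♯, ♭}` so that `L^∗_p(E,X)` is nonzero. The Pontryagin dual
  `X^∗(E/ℚ_∞)` … is a finitely generated torsion `ℤ_p[[X]]`-module"; at least one of `L^♯_p, L^♭_p`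
  is nonzero, Prop. 6.14) —, `L` = Sprung's `L^•_p(E,X) ∈ ℤ_p[[X]]` (Thm. 1.1:
  `L_p(E,α,X) = L^♯_p(E,X)·log^♯_α(1+X) + L^♭_p(E,X)·log^♭_α(1+X)`), `c` = its interpolation
  constant at the trivial character (§6, the table after Main Theorem 6.12, p. 1498: `L^♯_p(E,0)` and
  `L^♭_p(E,0)` are explicit integers, polynomial in `a_p` and `p`, times `L(E,1)/Ω⁺_E`; the chain asks
  only `3 ∤ c`, to be checked for the chosen `•` at `a_3 = ±3`);
* (MC•) Sprung's **Main Conjecture 1.3** `Char(X^•(E/ℚ_∞)) = (L^•_p(E,X))`, "equivalent to Kato's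
  [main conjecture]" (§7, p. 1486); (MC↑) its Kato side **Thm. 1.4** (`Char(X^•) ⊇ (L^•_p)` for
  non-CM `E` with `ρ_{E,p^∞}` onto `GL₂(ℤ_p)`) — in print; (MC↓) the Eisenstein side `L^• ∣ ξ^•` —
  OPEN class-wide: Sprung, Adv. Math. 449 (2024) 109741, Thm. 1.1 is CONDITIONAL on his Conj. 3.33;
  the predecessor arXiv:1610.10017 Thm. 4.1 is a PREPRINT and needs square-free `N`;
  Castella–Çiperiani–Skinner–Sprung arXiv:1804.10993 Thm. C is a PREPRINT (tree:
  `CastellaCiperianiSkinnerSprung2018.…OPEN`);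
* (K•) the ♯/♭ analogue of B. D. Kim's Euler characteristic, `|f^•(0)|_p = |#Sel_{p^∞}(E/ℚ)·∏_ℓ c_ℓ|_p`
  (no torsion term: `E[3]` irreducible on X8, `ClassX8.irr`) — in print as Sprung arXiv:1610.10017
  §4, Lemmas 4.4, 4.5, 4.8 with the small control theorem Lemma 4.7 (PREPRINT; quoted as such by
  Ray–Sprung, Ann. Inst. Fourier 75 (2025) §1.2: "the second author has … given an analogous formula
  of Kim's, all assuming that `F = ℚ`, see [26, Lemmas 4.4, 4.5, 4.8]"); whether the journal version
  (Adv. Math. 2024; not held, acq-07408) prints these lemmas unconditionally is OWED — until then (K•)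
  is a FLAGGED input (`Sprung16-EulerChar-PRE`), displayed as the explicit binder `D.EulerCharacteristic`.

PER-PAIR DISCHARGE OF (MC↓) — the "Kim/Kurihara certificate" of the coordinator's brief: Kim–Kim–Sun,
Selecta Math. 26 (2020), **Thm. 1.1** (PUBLISHED; hypotheses (NA) `a_p ≢ 1`, `a_p ≢ ψ(p) (mod λ)` — at
`p = 3`, `a_3 = ±3 ≡ 0` —, (Im) `ρ̄ ⊇ SL₂(𝔽_p)`, (Tam)): ONE non-zero mod-`p` Kurihara number `δ̃_n`
⇒ Kato's main conjecture for `(E, p)`; the paper's own §8.2.2 applies it to `y² = x³ − 67x + 926`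
(conductor `760`, good supersingular at `3`, `a_3 = 3` — an X8 curve). With Sprung 2012 §7 (each
♯/♭ main conjecture is equivalent to Kato's) this gives (MC•), hence (MC↓), per pair. FLAG
`KKS20@3-MR-H4`: KKS Lemma 4.3 takes Mazur–Rubin's hypotheses (H.1)–(H.4) from (Im); at `p = 3`
(H.4b) `p > 4` fails and (H.4a) fails for the self-dual `E[3]` — the located gap Sakamoto (Doc. Math.
2022, App. A) repairs in the ordinary setting and Kim (Amer. J. Math. 2026, §1.2.5) acknowledges; a
referee ruling decides whether the per-pair KKS discharge at `p = 3` is bookable (two-tier reading).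

Contents (compositions of tree theorems; the arithmetic is in the binders and the citations):
* `X8.bsdp_of_signedLowerDivisibility_of_surj_of_analyticRank_eq_zero` — X8 ∧ `r_an = 0` ∧ surj(3):
  Wuthrich Prop. 21 (PUB, `hW`) + GZK + modularity + a datum with (K•), (P•), `3 ∤ c`, (MC↓) ⇒ `BSDp W p`;
* `X8.bsdp_of_signedLowerDivisibility_of_semistable_of_analyticRank_eq_zero` — the same on X8 ∩ {sst},
  where surj(3) is automatic (`ClassX8.surj_of_semistable`, Serre 1972 Prop. 21 i));
* `X8.missingInputAt_of_signedLowerDivisibility_of_surj` — bookkeeping into the typed currency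
  `X8.MissingInputAt` of `Typed/X8.lean`.
Census (hyp SHARPENED §8): X8 = 325 ‖ 90 pairs (N < 2·10⁴ ‖ N < 10⁴); rank-`0` core 52 ‖ 19, of which
49 ‖ 18 with surj(3) and `9 ∣ #Ш_an` — the pairs these theorems address (modulo the binders), each
also decidable per pair by ONE descent bit `Ш(E)[3] ≠ 0` (Prop. 21 + Cassels–Tate; sha-2 tier T-full3).
Memo: `HOME/b2b-bsdres-additive-p3/X8-ROUTE-B.md`.

References: Sprung, J. Number Theory 132 (2012) Thms. 1.1, 1.2, 1.4, Main Conj. 1.3, Prop. 6.14,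
§6 p. 1498, §7 [Sprung2012]; Sprung arXiv:1610.10017 §4 (PRE); Sprung, Adv. Math. 449 (2024) 109741
(conditional); Kim–Kim–Sun, Selecta Math. 26 (2020) Thm. 1.1, Lemma 4.3, §8.2.2 [KimKimSun2020];
Ray–Sprung, Ann. Inst. Fourier 75 (2025) §1.2 [RaySprung2025]; Wuthrich, Doc. Math. 19 (2014) Prop. 21
[Wuthrich2014]; Serre 1972 Props. 12, 21 [Serre1972]; Miller 2011 Def. 1.1 [Miller2011LMS];
cell files HOME/b2b-bsdres-x10b/X6-ROUTE.md, CLASS-OWNERS.md rows X6/X8.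
-/

set_option autoImplicit false

noncomputable section

open scoped Classical

open WeierstrassCurve Literature.NumberTheory.EllipticCurves
  Literature.NumberTheory.EllipticCurves.Rank1Residual
  Literature.NumberTheory.EllipticCurves.Rank1Residual.Typed

namespace Summit.BirchSwinnertonDyer.Rank1Residual.Supersingular

variable (W : WeierstrassCurve ℚ) [W.IsElliptic] [W.IsGloballyMinimal] (p : ℕ) [Fact p.Prime]

/-- **X8 ∧ `r_an = 0` ∧ surj(3): `BSD(E,3)` from ONE chromatic divisibility.** On class X8
(`ClassX8 W p`: `p = 3`, good supersingular at `3`, `a_3 ≠ 0`) in analytic rank `0` with `ρ̄_{E,3}`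
surjective, granted Wuthrich 2014 Prop. 21 (`hW`, PUB: the UPPER bound `ord_3 #Ш ≤ ord_3 #Ш_an`),
GZK (`hGZK`) and modularity (`hmod`): a signed datum — read as Sprung's `(ξ^•, L^•_p, c^•)`,
`• ∈ {♯, ♭}` with `L^•_p ≠ 0` — satisfying the Euler characteristic (K•), the interpolation (P•) with
`3 ∤ c`, and the Eisenstein divisibility (MC↓) `L^• ∣ ξ^•`, gives Miller's `BSDp W p`. Irreducibility
of `E[3]` is automatic (`ClassX8.irr'`). The inputs NOT in refereed print are displayed as binders:
(K•) = Sprung arXiv:1610.10017 Lemmas 4.4–4.8 (PRE; flag `Sprung16-EulerChar-PRE`), (MC↓) = OPEN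
class-wide (Sprung 2024 conditional; CCSS PRE) / per pair KKS 2020 Thm. 1.1 + Sprung 2012 §7 (flag
`KKS20@3-MR-H4`). Per pair; NOT a class theorem. [cite: Sprung2012, Thm. 1.2, Main Conj. 1.3, Thm. 1.4, §6 (p. 1498), §7 (p. 1486)]
[cite: KimKimSun2020, Thm. 1.1 and §8.2.2] [cite: Wuthrich2014, Prop. 21 (p. 400)] [cite: Miller2011LMS, Def. 1.1] -/
theorem X8.bsdp_of_signedLowerDivisibility_of_surj_of_analyticRank_eq_zero
    (hW : Wuthrich2014.sha_dvd_analyticSha)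
    (hGZK : rank_eq_analyticRank_of_analyticRank_le_one) (hmod : hasEntireLFunction_rat)
    (hX : ClassX8 W p) (hs : Surj W p) (h0 : W.analyticRank = 0)
    (D : SignedDatum W p) (hc : ¬ p ∣ D.c) (hK : D.EulerCharacteristic) (hP : D.Interpolation)
    (hdiv : D.LowerDivisibility) : BSDp W p := by
  have hL : W.entireLFunction 1 ≠ 0 := (W.analyticRank_eq_zero_iff_holds (hmod W)).1 h0
  exact X8.bsdp_of_missingLowerBoundAt_of_surj W p hW hGZK hmod hX hs h0
    (missingLowerBoundAt_of_signedLowerDivisibility W p hGZK (ClassX8.irr' W p hX) hL D hc hK hP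
      hdiv)

/-- **X8 ∩ {sst} ∧ `r_an = 0`: `BSD(E,3)` from ONE chromatic divisibility**, the surjectivity of
`ρ̄_{E,3}` being automatic for a SEMISTABLE X8 curve (`ClassX8.surj_of_semistable`, Serre 1972 §5.4
Prop. 21 i)). Same binders as `X8.bsdp_of_signedLowerDivisibility_of_surj_of_analyticRank_eq_zero`.
Per pair; NOT a class theorem. [cite: Sprung2012, Thm. 1.2, Main Conj. 1.3, Thm. 1.4, §7]
[cite: Serre1972, §5.4 Prop. 21 i)] [cite: Wuthrich2014, Prop. 21 (p. 400)] [cite: Miller2011LMS, Def. 1.1] -/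
theorem X8.bsdp_of_signedLowerDivisibility_of_semistable_of_analyticRank_eq_zero
    (hW : Wuthrich2014.sha_dvd_analyticSha)
    (hGZK : rank_eq_analyticRank_of_analyticRank_le_one) (hmod : hasEntireLFunction_rat)
    (hX : ClassX8 W p) (hsst : Semistable W) (h0 : W.analyticRank = 0)
    (D : SignedDatum W p) (hc : ¬ p ∣ D.c) (hK : D.EulerCharacteristic) (hP : D.Interpolation)
    (hdiv : D.LowerDivisibility) : BSDp W p := by
  have hL : W.entireLFunction 1 ≠ 0 := (W.analyticRank_eq_zero_iff_holds (hmod W)).1 h0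
  exact X8.bsdp_of_missingLowerBoundAt_of_semistable W p hW hGZK hmod hX hsst h0
    (missingLowerBoundAt_of_signedLowerDivisibility W p hGZK (ClassX8.irr' W p hX) hL D hc hK hP
      hdiv)

/-- **Bookkeeping: the chromatic divisibility delivers the typed missing input of X8** in analytic
rank `0` with surjective image (`X8.MissingInputAt`, `Typed/X8.lean`: there the missing input IS the
lower bound `MissingLowerBoundAt W p`). [cite: Sprung2012, Main Conj. 1.3 and §7] [cite: Miller2011LMS, Def. 1.1] -/
theorem X8.missingInputAt_of_signedLowerDivisibility_of_surj
    (hGZK : rank_eq_analyticRank_of_analyticRank_le_one) (hmod : hasEntireLFunction_rat)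
    (hX : ClassX8 W p) (hs : Surj W p) (h0 : W.analyticRank = 0)
    (D : SignedDatum W p) (hc : ¬ p ∣ D.c) (hK : D.EulerCharacteristic) (hP : D.Interpolation)
    (hdiv : D.LowerDivisibility) : X8.MissingInputAt W p := by
  have hL : W.entireLFunction 1 ≠ 0 := (W.analyticRank_eq_zero_iff_holds (hmod W)).1 h0
  have hlow : MissingLowerBoundAt W p :=
    missingLowerBoundAt_of_signedLowerDivisibility W p hGZK (ClassX8.irr' W p hX) hL D hc hK hP hdiv
  exact (X8.missingInputAt_iff_of_analyticRank_eq_zero W p hX h0).mpr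
    ⟨fun _ => hlow, fun hns => absurd hs hns⟩

end Summit.BirchSwinnertonDyer.Rank1Residual.Supersingular

end
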